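/-
Copyright (c) 2026. All rights reserved.
Released under Apache 2.0 license as described in the file LICENSE.
-/
import Literature.AlgebraicGeometry.CossartPiltant200819.DiagonalTameAction2008
import Mathlib.FieldTheory.Galois.Basic
import Mathlib.RingTheory.Polynomial.Cyclotomic.Roots
import Mathlib.RingTheory.RegularLocalRing.Defs
import HarnessLib

/-!
# Cossart–Piltant 2008, Prop 6.2 (2) inside the proof of Lemma 9.4: diagonal coordinates in `S`

[CossartPiltant2008] Lemma 9.4, proof, HAL hal-00139124 p. 29 l. 14–23 (journal J. Algebra 320
(2008), Lemma 9.2), VERBATIM: "In other terms, it can be assumed that `μ_l ⊂ K`. Let `R₀` be a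
normal local model of `V/k` satisfying the conclusion of proposition 6.2, and let `S` be a local
uniformization of `W/k` such that `R̃₀ < S`. We have `k(ζ_l) ⊂ S`. Also `S` is stable by `G` …
Let `R := S^G`. … By proposition 6.2, we have `G_i(S/R) = G`, `κ(R) = κ(S)`, and the action on
`Ŝ ≃ κ(S)[[x₁, x₂, x₃]]` is given by `g.x_i = ζ_l^{t_i} x_i`, where `g` is a generator of `G`
and `t_i ≢ 0 mod l` for some `i`. Note that it can be assumed that `x₁, x₂, x₃ ∈ S` by (29),
since `k(ζ_l) ⊂ S`." Here `L/K` is Galois of prime degree `l ≠ p` with group `G` (Lemma 9.4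
statement, the last six lines of HAL p. 28, and p. 29 l. 5), `ζ_l` a primitive `l`-th root of
unity.

This file PROVES the displayed consequences of Prop. 6.2 (2) in exactly this frame — eigen
coordinates in `S` (an r.s.p. when `S` is regular), "`κ(R) = κ(S)`" elementwise, and "`t_i ≢ 0
mod l` for some `i`" — at finite level (no completion), from the finite-level form of (28)–(30)
(`DiagonalTameAction2008.exists_eigenvectors_span_maximalIdeal`) and Reynolds averaging:

* `exists_eigenvectors_span_maximalIdeal_of_stable` — for `L/K` finite, `S ⊆ L` a `k`-subalgebra
  which is a Noetherian local ring, stable under a commutative `Aut_K(L)` ("`S` is stable by `G`",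
  `G` Abelian), and `ζ ∈ S` a primitive `ε`-th root of unity fixed by `Aut_K(L)` (`ε` the exponent
  of `Aut_K(L)`; "`k(ζ_l) ⊂ S`", "`μ_l ⊂ K`"): there are finitely many `y_i ∈ m_S` GENERATING `m_S`,
  with `κ(S)`-linearly independent initial forms (a minimal system of generators; an r.s.p. when
  `S` is regular), and exponents `t_i(σ)` with `σ(y_i) = ζ^{t_i(σ)} y_i` for every `σ` — "the
  action … is given by `g.x_i = ζ_l^{t_i} x_i` … it can be assumed that `x₁, x₂, x₃ ∈ S` by (29),
  since `k(ζ_l) ⊂ S`".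
* `exists_eigenvectors_span_maximalIdeal_of_prime_degree` — the same for `L/K` Galois of prime
  degree `l` and `ζ ∈ S` a primitive `l`-th root of unity: then `G` is cyclic of order `l`
  (exponent `l`) and `ζ ∈ K` AUTOMATICALLY (`algebraMap_mem_of_isPrimitiveRoot_finrank`:
  `[K(ζ) : K]` divides `l` and is `≤ l − 1`), so that no hypothesis "`μ_l ⊂ K`" is needed once
  `ζ_l ∈ L` — the printed reduction "First assume that `μ_l ⊄ K` …" (HAL p. 29 l. 6–13) concerns
  adjoining `ζ_l` to `L` itself.
* `exists_rsp_eigenvectors_of_stable`, `exists_rsp_eigenvectors_of_prime_degree` — for `S`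
  REGULAR (Mathlib `IsRegularLocalRing`): the eigen-generators number `dim S`, i.e. form a regular
  system of parameters of `S` ("`S` has r.s.p. `(x₁, x₂, x₃)` … `g.x_i = ζ_l^{t_i} x_i` …
  `x₁, x₂, x₃ ∈ S`"; `IsRegularLocalRing.iff_finrank_cotangentSpace`), via
  `span_toCotangent_eq_top_of_span_eq`.
* `apply_eq_self_of_apply_generators_eq`, `exists_pow_ne_one_of_exists_apply_ne` — "`t_i ≢ 0
  mod l` for some `i`" at finite level: a ring endomorphism of a Noetherian local ring fixing
  generators of `m_S`, with every element congruent mod `m_S` to a fixed element ("`κ(R) = κ(S)`",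
  Prop. 6.2 (27)), is the identity (twisted derivation + Krull intersection theorem); hence a
  `σ` moving some element of `S` has some eigenvalue `ζ^{t_i} ≠ 1`.
* `exists_fixed_valuation_sub_lt_of_stable` — "`κ(R) = κ(S)`" (l. 17–18) for a `G`-stable
  `S ⊆ W` with `G` inertial and `|G|` invertible, elementwise (every `η ∈ S` is congruent mod
  `m_W` to a `G`-invariant element of `S`); `mem_maximalIdeal_of_valuation_lt_one`
  (`m_W ∩ S ⊆ m_S`); `exists_pow_ne_one_of_stable_of_inertial` — the two combined with the
  faithfulness lemma: "`t_i ≢ 0 mod l` for some `i`" from the data of l. 14–18 alone.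

Dictionary: "`S` is stable by `G`" = `∀ σ, ∀ x ∈ S, σ x ∈ S` (for the finite group `Aut_K(L)` this
is `σ(S) = S`); the `G`-action on the local ring `↥S` and the `k(ζ)`-algebra structure
`k(ζ) = k⟮ζ⟯ ⊆ S` (`ζ` is integral over `k`, so `k⟮ζ⟯ = k[ζ] ⊆ S`) are built inside the proof;
`G` acts `k(ζ)`-linearly because it fixes `k` and `ζ`; `HasEnoughRootsOfUnity k⟮ζ⟯ ε` from `ζ`.
"`G = G_i(W/V)`" (l. 5) = `∀ σ, ∀ x ∈ W, W.valuation (σ x - x) < 1`; "`l ≠ p`" =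
`|Aut_K(L)|` invertible in `L`. NOT used and NOT asserted: the model-level statements
"`R := S^G` is a normal local model of `V/k` and `S` lies above `R`" (l. 16–17) and
"`G_i(S/R) = G`" (l. 17), the completion `Ŝ ≃ κ(S)[[x₁, x₂, x₃]]`, `QF(S) = L` (which is what
makes a generator `g ≠ 1` move some element of `S`, the hypothesis `hmove` below), and the
disputed `G`-stability sentence of HAL p. 29 l. 15–16 (see `TameDescent2008.lean`; here stability
is a HYPOTHESIS, as in `GStableUniformizationAbove`).

AI-written reading aid; nothing here has been reviewed by the authors or by an expert.

## Sources
- [CossartPiltant2008] V. Cossart, O. Piltant, Resolution of singularities of threefolds in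
  positive characteristic I, J. Algebra 320 (2008) 1051–1082; HAL hal-00139124v1: Lemma 9.4
  (statement: the last six lines of HAL p. 28) and its proof (HAL p. 29 l. 3–23), Prop 6.2 (2)
  (p. 17–19, (28)–(30)).  "HAL p. N" = printed page `N` of the manuscript (page file
  `p00(N+1).txt` of the held text `paper:doi-10-1016-j-jalgebra-2008-03-032`).
-/

noncomputable section

namespace Literature.AlgebraicGeometry.CossartPiltant200819.CP2008

open IsLocalRing
open scoped IntermediateField

universe u

variable {k K L : Type u} [Field k] [Field K] [Field L] [Algebra k K] [Algebra K L] [Algebra k L]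
  [IsScalarTower k K L]

/-! ### "`μ_l ⊂ K`" is automatic: a primitive `[L:K]`-th root of unity in `L`, `[L:K]` prime -/

omit [IsScalarTower k K L] [Algebra k L] [Algebra k K] [Field k] in
/-- **"it can be assumed that `μ_l ⊂ K`"** (HAL p. 29 l. 13), in the strong form: if `[L : K] = l`
is prime and `ζ ∈ L` is a primitive `l`-th root of unity, then `ζ ∈ K` — `[K(ζ) : K]` divides
`l` (tower law) and is at most `deg Φ_l = l − 1` (`ζ` is a root of the cyclotomic polynomial,
`l ≠ 0` in `L` being forced by primitivity). Standard field theory, recorded as the ground for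
the printed reduction "First assume that `μ_l ⊄ K` … In other terms, it can be assumed that
`μ_l ⊂ K`" (HAL p. 29 l. 6–13) in the case `ζ_l ∈ L`.
[cite: CossartPiltant2008, Lemma 9.4, proof (HAL p. 29 l. 6–13)] -/
theorem algebraMap_mem_of_isPrimitiveRoot_finrank [FiniteDimensional K L]
    (hl : (Module.finrank K L).Prime) {ζ : L} (hζ : IsPrimitiveRoot ζ (Module.finrank K L)) :
    ζ ∈ Set.range (algebraMap K L) := by
  set l := Module.finrank K L with hl_def
  haveI : NeZero l := ⟨hl.ne_zero⟩
  haveI : NeZero ((l : ℕ) : L) := hζ.neZero'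
  have hint : IsIntegral K ζ := .of_finite K ζ
  have hroot : Polynomial.aeval ζ (Polynomial.cyclotomic l K) = 0 := by
    rw [Polynomial.aeval_def, ← Polynomial.eval_map, Polynomial.map_cyclotomic]
    exact (Polynomial.isRoot_cyclotomic_iff.mpr hζ).eq_zero
  have hdeg : (minpoly K ζ).natDegree ≤ l - 1 := by
    have h := Polynomial.natDegree_le_of_dvd (minpoly.dvd K ζ hroot)
      (Polynomial.cyclotomic_ne_zero l K)
    rwa [Polynomial.natDegree_cyclotomic, Nat.totient_prime hl] at h
  have hdvd : Module.finrank K K⟮ζ⟯ ∣ l :=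
    Dvd.intro _ (Module.finrank_mul_finrank K K⟮ζ⟯ L)
  have hfin : Module.finrank K K⟮ζ⟯ = (minpoly K ζ).natDegree :=
    IntermediateField.adjoin.finrank hint
  have h1 : Module.finrank K K⟮ζ⟯ = 1 := by
    rcases (Nat.dvd_prime hl).mp hdvd with h | h
    · exact h
    · exfalso
      have : l ≤ l - 1 :=
        calc l = Module.finrank K K⟮ζ⟯ := h.symm
          _ = (minpoly K ζ).natDegree := hfin
          _ ≤ l - 1 := hdeg
      have h2 := hl.two_le
      omega
  have hbot : K⟮ζ⟯ = ⊥ := IntermediateField.finrank_eq_one_iff.mp h1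
  have hζmem : ζ ∈ (⊥ : IntermediateField K L) := hbot ▸ IntermediateField.mem_adjoin_simple_self K ζ
  exact IntermediateField.mem_bot.mp hζmem

omit [IsScalarTower k K L] [Algebra k L] [Algebra k K] [Field k] in
/-- `ζ ∈ K` in the form used below: every `K`-automorphism of `L` fixes `ζ` ("`G` acts trivially
on `μ_l`", HAL p. 29 l. 8). [cite: CossartPiltant2008, Lemma 9.4, proof (HAL p. 29 l. 6–13)] -/
theorem map_eq_self_of_isPrimitiveRoot_finrank [FiniteDimensional K L]
    (hl : (Module.finrank K L).Prime) {ζ : L} (hζ : IsPrimitiveRoot ζ (Module.finrank K L))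
    (σ : L ≃ₐ[K] L) : σ ζ = ζ := by
  obtain ⟨c, rfl⟩ := algebraMap_mem_of_isPrimitiveRoot_finrank hl hζ
  exact σ.commutes c

/-! ### Diagonal coordinates in a `G`-stable local ring `S ∋ ζ` -/

/-- **Cossart–Piltant 2008, Lemma 9.4 proof / Prop 6.2 (2) — PROVED**: "the action … is given by
`g.x_i = ζ_l^{t_i} x_i` … it can be assumed that `x₁, x₂, x₃ ∈ S` by (29), since `k(ζ_l) ⊂ S`".
For `L/K` finite with COMMUTATIVE automorphism group, `S ⊆ L` a `k`-subalgebra that is a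
Noetherian local ring stable under `Aut_K(L)`, and `ζ ∈ S` a primitive `ε`-th root of unity fixed by
`Aut_K(L)` (`ε` = the exponent of `Aut_K(L)`): `m_S` is generated by finitely many `y_i` with
`κ(S)`-independent initial forms and `σ(y_i) = ζ^{t_i(σ)} y_i` for all `σ`. Instance of
`exists_eigenvectors_span_maximalIdeal` with `k₀ = k⟮ζ⟯ ⊆ S`, `H = Aut_K(L)`.
[cite: CossartPiltant2008, Lemma 9.4, proof (HAL p. 29 l. 14–23); Prop 6.2 (2), (28)-(30)] -/
theorem exists_eigenvectors_span_maximalIdeal_of_stable [FiniteDimensional K L]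
    (S : Subalgebra k L) [IsLocalRing S] [IsNoetherianRing S]
    (hstab : ∀ σ : L ≃ₐ[K] L, ∀ x ∈ S, σ x ∈ S)
    (hcomm : ∀ σ τ : L ≃ₐ[K] L, σ * τ = τ * σ)
    {ζ : L} (hζS : ζ ∈ S) (hζσ : ∀ σ : L ≃ₐ[K] L, σ ζ = ζ)
    (hζ : IsPrimitiveRoot ζ (Monoid.exponent (L ≃ₐ[K] L))) :
    ∃ (ι : Type u) (_ : Fintype ι) (y : ι → ↥(maximalIdeal S)) (t : ι → (L ≃ₐ[K] L) → ℕ),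
      (∀ i (σ : L ≃ₐ[K] L), σ ((y i : S) : L) = ζ ^ t i σ * ((y i : S) : L)) ∧
      LinearIndependent (ResidueField S) (fun i => (maximalIdeal S).toCotangent (y i)) ∧
      Ideal.span (Set.range fun i => (y i : S)) = maximalIdeal S := by
  classical
  set n := Monoid.exponent (L ≃ₐ[K] L) with hn
  have hn0 : n ≠ 0 := Monoid.exponent_ne_zero_of_finite
  haveI : NeZero n := ⟨hn0⟩
  have hζint : IsIntegral k ζ :=
    IsIntegral.of_pow (Nat.pos_of_ne_zero hn0) (by rw [hζ.pow_eq_one]; exact isIntegral_one)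
  -- the field `k(ζ) = k⟮ζ⟯ ⊆ S`, pointwise fixed by every `σ`
  set F : IntermediateField k L := k⟮ζ⟯ with hF
  have hFadj : F.toSubalgebra = Algebra.adjoin k {ζ} :=
    IntermediateField.adjoin_simple_toSubalgebra_of_isAlgebraic hζint.isAlgebraic
  have hFS : ∀ x : L, x ∈ F → x ∈ S := by
    intro x hx
    have hx' : x ∈ F.toSubalgebra := hx
    rw [hFadj] at hx'
    exact (Algebra.adjoin_le (Set.singleton_subset_iff.mpr hζS) : Algebra.adjoin k {ζ} ≤ S) hx'
  have hFσ : ∀ (σ : L ≃ₐ[K] L) (x : L), x ∈ F → σ x = x := by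
    intro σ x hx
    let Fix : Subalgebra k L :=
      { carrier := {x | σ x = x}
        mul_mem' := fun {a b} ha hb => by
          simp only [Set.mem_setOf_eq] at ha hb ⊢
          rw [map_mul, ha, hb]
        add_mem' := fun {a b} ha hb => by
          simp only [Set.mem_setOf_eq] at ha hb ⊢
          rw [map_add, ha, hb]
        algebraMap_mem' := fun c => by
          show σ (algebraMap k L c) = algebraMap k L c
          rw [IsScalarTower.algebraMap_apply k K L]
          exact σ.commutes _ }
    have hx' : x ∈ F.toSubalgebra := hx
    rw [hFadj] at hx'
    exact (Algebra.adjoin_le (Set.singleton_subset_iff.mpr (hζσ σ)) : Algebra.adjoin k {ζ} ≤ Fix)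
      hx'
  -- the commutative group `G = Aut_K(L)` and its action on the local ring `S`
  letI instCG : CommGroup (L ≃ₐ[K] L) :=
    { (inferInstance : Group (L ≃ₐ[K] L)) with mul_comm := hcomm }
  letI instAct : MulSemiringAction (L ≃ₐ[K] L) S :=
    { smul := fun σ x => ⟨σ x, hstab σ x x.2⟩
      one_smul := fun x => rfl
      mul_smul := fun σ τ x => rfl
      smul_zero := fun σ => Subtype.ext (map_zero σ)
      smul_add := fun σ x y => Subtype.ext (map_add σ _ _)
      smul_one := fun σ => Subtype.ext (map_one σ)
      smul_mul := fun σ x y => Subtype.ext (map_mul σ _ _) }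
  have smul_val : ∀ (σ : L ≃ₐ[K] L) (x : S), ((σ • x : S) : L) = σ x := fun _ _ => rfl
  -- the `k⟮ζ⟯`-algebra structure of `S`, commuting with the action
  let f : F →+* S :=
    { toFun := fun c => ⟨(c : L), hFS c c.2⟩
      map_one' := rfl
      map_mul' := fun _ _ => rfl
      map_zero' := rfl
      map_add' := fun _ _ => rfl }
  letI instAlg : Algebra F S := f.toAlgebra
  have smulF_val : ∀ (c : F) (x : S), ((c • x : S) : L) = (c : L) * (x : L) := fun c x => by
    rw [Algebra.smul_def]; rfl
  letI instComm : SMulCommClass (L ≃ₐ[K] L) F S :=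
    ⟨fun σ c x => by
      apply Subtype.ext
      rw [smul_val, smulF_val, smulF_val, smul_val, map_mul, hFσ σ c c.2]⟩
  -- enough roots of unity in `k⟮ζ⟯`
  let ζF : F := ⟨ζ, IntermediateField.mem_adjoin_simple_self k ζ⟩
  have hζF : IsPrimitiveRoot ζF n :=
    IsPrimitiveRoot.of_map_of_injective (f := algebraMap F L) (by exact hζ)
      (algebraMap F L).injective
  haveI instRoots : HasEnoughRootsOfUnity F (Monoid.exponent (L ≃ₐ[K] L)) :=
    ⟨⟨ζF, hζF⟩, inferInstance⟩
  -- (28)–(30) at finite level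
  obtain ⟨ι, hfin, y, χ, hχ, hli, hspan⟩ :=
    exists_eigenvectors_span_maximalIdeal (k₀ := F) (S := S) (H := L ≃ₐ[K] L)
  -- characters of `G` take values in `μ_ε = ⟨ζ⟩`
  have ht : ∀ (i : ι) (σ : L ≃ₐ[K] L), ∃ t : ℕ, ζF ^ t = ((χ i σ : Fˣ) : F) := fun i σ => by
    have hσn : σ ^ n = 1 := by rw [hn]; exact Monoid.pow_exponent_eq_one σ
    have h1 : (((χ i σ : Fˣ) : F)) ^ n = 1 := by
      rw [← Units.val_pow_eq_pow_val, ← map_pow, hσn, map_one, Units.val_one]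
    obtain ⟨t, -, ht⟩ := hζF.eq_pow_of_pow_eq_one h1
    exact ⟨t, ht⟩
  choose t ht using ht
  refine ⟨ι, hfin, y, t, fun i σ => ?_, hli, hspan⟩
  have h := congrArg (fun z : S => (z : L)) (hχ i σ)
  rw [smul_val, smulF_val, ← ht i σ] at h
  rw [h]
  rfl

/-- **Cossart–Piltant 2008, Lemma 9.4 proof / Prop 6.2 (2), prime degree — PROVED**: for `L/K`
Galois of prime degree `l`, `S ⊆ L` a `k`-subalgebra that is a Noetherian local ring stable under
`G = Gal(L/K)`, and `ζ ∈ S` a primitive `l`-th root of unity ("`k(ζ_l) ⊂ S`"), there are finitely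
many `y_i ∈ m_S` generating `m_S`, with `κ(S)`-linearly independent initial forms, and exponents
`t_i(σ)` with `σ(y_i) = ζ^{t_i(σ)} y_i` ("`g.x_i = ζ_l^{t_i} x_i`, … `x₁, x₂, x₃ ∈ S`"). `G` is
cyclic of order `l`, so commutative of exponent `l`, and `ζ ∈ K` by
`algebraMap_mem_of_isPrimitiveRoot_finrank`.
[cite: CossartPiltant2008, Lemma 9.4, proof (HAL p. 29 l. 3–23); Prop 6.2 (2), (28)-(30)] -/
theorem exists_eigenvectors_span_maximalIdeal_of_prime_degree [FiniteDimensional K L]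
    [IsGalois K L] (hl : (Module.finrank K L).Prime)
    (S : Subalgebra k L) [IsLocalRing S] [IsNoetherianRing S]
    (hstab : ∀ σ : L ≃ₐ[K] L, ∀ x ∈ S, σ x ∈ S)
    {ζ : L} (hζS : ζ ∈ S) (hζ : IsPrimitiveRoot ζ (Module.finrank K L)) :
    ∃ (ι : Type u) (_ : Fintype ι) (y : ι → ↥(maximalIdeal S)) (t : ι → (L ≃ₐ[K] L) → ℕ),
      (∀ i (σ : L ≃ₐ[K] L), σ ((y i : S) : L) = ζ ^ t i σ * ((y i : S) : L)) ∧
      LinearIndependent (ResidueField S) (fun i => (maximalIdeal S).toCotangent (y i)) ∧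
      Ideal.span (Set.range fun i => (y i : S)) = maximalIdeal S := by
  classical
  have hcard : Nat.card (L ≃ₐ[K] L) = Module.finrank K L := IsGalois.card_aut_eq_finrank K L
  haveI : Fact (Module.finrank K L).Prime := ⟨hl⟩
  haveI hcyc : IsCyclic (L ≃ₐ[K] L) := isCyclic_of_prime_card hcard
  have hcomm : ∀ σ τ : L ≃ₐ[K] L, σ * τ = τ * σ := fun σ τ => by
    letI := IsCyclic.commGroup (α := L ≃ₐ[K] L)
    exact mul_comm σ τ
  have hexp : Monoid.exponent (L ≃ₐ[K] L) = Module.finrank K L := by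
    rw [IsCyclic.exponent_eq_card, hcard]
  exact exists_eigenvectors_span_maximalIdeal_of_stable S hstab hcomm hζS
    (map_eq_self_of_isPrimitiveRoot_finrank hl hζ) (hexp ▸ hζ)

/-! ### Regular `S`: an r.s.p. of eigenvectors -/

/-- From eigen-generators with independent initial forms to the cotangent space: the images span
`m_S/m_S²`. [folklore plumbing for `IsLocalRing.CotangentSpace.span_image_eq_top_iff`]
[cite: CossartPiltant2008, Prop 6.2 (2), (30) (HAL p. 19 l. 15–17)] -/
theorem span_toCotangent_eq_top_of_span_eq {S : Type u} [CommRing S] [IsLocalRing S]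
    [IsNoetherianRing S] {ι : Type*} (y : ι → ↥(maximalIdeal S))
    (hspan : Ideal.span (Set.range fun i => (y i : S)) = maximalIdeal S) :
    Submodule.span (ResidueField S) (Set.range fun i => (maximalIdeal S).toCotangent (y i)) = ⊤ := by
  have hr : Set.range (fun i => (maximalIdeal S).toCotangent (y i)) =
      (maximalIdeal S).toCotangent '' Set.range y := by
    rw [← Set.range_comp]; rfl
  rw [hr, IsLocalRing.CotangentSpace.span_image_eq_top_iff]
  apply Submodule.map_injective_of_injective (maximalIdeal S).injective_subtype
  rw [Submodule.map_span, Submodule.map_subtype_top]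
  have hr' : ((maximalIdeal S).subtype '' Set.range y : Set S) = Set.range fun i => (y i : S) := by
    rw [← Set.range_comp]; rfl
  rw [hr']
  exact hspan

/-- **Cossart–Piltant 2008, Lemma 9.4 proof / Prop 6.2 (2), r.s.p. form — PROVED**: "`S` has
r.s.p. `(x₁, x₂, x₃)` … `g.x_i = ζ_l^{t_i} x_i` … `x₁, x₂, x₃ ∈ S`" for `S` REGULAR: under the
hypotheses of `exists_eigenvectors_span_maximalIdeal_of_stable` with `S` a regular local ring, the
eigen-generators `y_i` of `m_S` number `dim S` — a regular system of parameters of `S` consisting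
of `Aut_K(L)`-eigenvectors (`IsRegularLocalRing.iff_finrank_cotangentSpace`).
[cite: CossartPiltant2008, Lemma 9.4, proof (HAL p. 29 l. 14–23); Prop 6.2 (2), (30)] -/
theorem exists_rsp_eigenvectors_of_stable [FiniteDimensional K L]
    (S : Subalgebra k L) [IsRegularLocalRing S]
    (hstab : ∀ σ : L ≃ₐ[K] L, ∀ x ∈ S, σ x ∈ S)
    (hcomm : ∀ σ τ : L ≃ₐ[K] L, σ * τ = τ * σ)
    {ζ : L} (hζS : ζ ∈ S) (hζσ : ∀ σ : L ≃ₐ[K] L, σ ζ = ζ)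
    (hζ : IsPrimitiveRoot ζ (Monoid.exponent (L ≃ₐ[K] L))) :
    ∃ (ι : Type u) (_ : Fintype ι) (y : ι → ↥(maximalIdeal S)) (t : ι → (L ≃ₐ[K] L) → ℕ),
      (Fintype.card ι : WithBot ℕ∞) = ringKrullDim S ∧
      (∀ i (σ : L ≃ₐ[K] L), σ ((y i : S) : L) = ζ ^ t i σ * ((y i : S) : L)) ∧
      Ideal.span (Set.range fun i => (y i : S)) = maximalIdeal S := by
  obtain ⟨ι, hfin, y, t, heig, hli, hspan⟩ :=
    exists_eigenvectors_span_maximalIdeal_of_stable S hstab hcomm hζS hζσ hζ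
  refine ⟨ι, hfin, y, t, ?_, heig, hspan⟩
  have htop := span_toCotangent_eq_top_of_span_eq y hspan
  let b : Module.Basis ι (ResidueField S) (CotangentSpace S) := Module.Basis.mk hli htop.ge
  rw [← (IsRegularLocalRing.iff_finrank_cotangentSpace S).mp inferInstance,
    Module.finrank_eq_card_basis b]

/-- **Cossart–Piltant 2008, Lemma 9.4 proof / Prop 6.2 (2), r.s.p. form, prime degree —
PROVED**: for `L/K` Galois of prime degree `l`, `S ⊆ L` a REGULAR local `k`-subalgebra stable
under `G = Gal(L/K)` with `ζ_l ∈ S`: `S` has a regular system of parameters `(y_i)` (`dim S`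
elements generating `m_S`) with `σ(y_i) = ζ_l^{t_i(σ)} y_i` — the printed "`S` has r.s.p.
`(x₁, x₂, x₃)` with `g.x_i = ζ_l^{t_i} x_i`, `x_i ∈ S`" (there `dim S = 3`).
[cite: CossartPiltant2008, Lemma 9.4, proof (HAL p. 29 l. 14–23); Prop 6.2 (2), (30)] -/
theorem exists_rsp_eigenvectors_of_prime_degree [FiniteDimensional K L] [IsGalois K L]
    (hl : (Module.finrank K L).Prime) (S : Subalgebra k L) [IsRegularLocalRing S]
    (hstab : ∀ σ : L ≃ₐ[K] L, ∀ x ∈ S, σ x ∈ S)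
    {ζ : L} (hζS : ζ ∈ S) (hζ : IsPrimitiveRoot ζ (Module.finrank K L)) :
    ∃ (ι : Type u) (_ : Fintype ι) (y : ι → ↥(maximalIdeal S)) (t : ι → (L ≃ₐ[K] L) → ℕ),
      (Fintype.card ι : WithBot ℕ∞) = ringKrullDim S ∧
      (∀ i (σ : L ≃ₐ[K] L), σ ((y i : S) : L) = ζ ^ t i σ * ((y i : S) : L)) ∧
      Ideal.span (Set.range fun i => (y i : S)) = maximalIdeal S := by
  obtain ⟨ι, hfin, y, t, heig, hli, hspan⟩ :=
    exists_eigenvectors_span_maximalIdeal_of_prime_degree hl S hstab hζS hζ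
  refine ⟨ι, hfin, y, t, ?_, heig, hspan⟩
  have htop := span_toCotangent_eq_top_of_span_eq y hspan
  let b : Module.Basis ι (ResidueField S) (CotangentSpace S) := Module.Basis.mk hli htop.ge
  rw [← (IsRegularLocalRing.iff_finrank_cotangentSpace S).mp inferInstance,
    Module.finrank_eq_card_basis b]

/-! ### "`t_i ≢ 0 mod l` for some `i`": faithfulness at finite level -/

/-- **Finite-level faithfulness lemma** (the content of "`g.x_i = ζ_l^{t_i} x_i` … and
`t_i ≢ 0 mod l` for some `i`", HAL p. 29 l. 20–21, whose printed justification is that `G` acts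
faithfully and `κ(S)`-linearly on `Ŝ ≃ κ(S)[[x₁, x₂, x₃]]`): let `S` be a Noetherian local ring,
`σ` a ring endomorphism of `S` fixing a generating set `(y_i)` of `m_S` and such that every
element of `S` is congruent modulo `m_S` to a `σ`-fixed element ("`κ(R) = κ(S)`", `R = S^G`,
Prop. 6.2 (27)). Then `σ = id`: the twisted derivation `δ = σ − id` satisfies `δ(S) ⊆ m_S^n` for
all `n` (induction, `δ(bc) = σ(b)δ(c) + δ(b)c`), and `⋂ m_S^n = 0` (Krull,
`Ideal.iInf_pow_eq_bot_of_isLocalRing`) — no completion needed.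
[cite: CossartPiltant2008, Lemma 9.4, proof (HAL p. 29 l. 20–21)] -/
theorem apply_eq_self_of_apply_generators_eq {S : Type*} [CommRing S] [IsLocalRing S]
    [IsNoetherianRing S] (σ : S →+* S) {ι : Type*} (y : ι → S)
    (hspan : Ideal.span (Set.range y) = maximalIdeal S) (hy : ∀ i, σ (y i) = y i)
    (hres : ∀ a : S, ∃ θ : S, σ θ = θ ∧ a - θ ∈ maximalIdeal S) (a : S) : σ a = a := by
  have key : ∀ n : ℕ, ∀ a : S, σ a - a ∈ maximalIdeal S ^ n := by
    intro n
    induction n with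
    | zero => intro a; simp
    | succ n ih =>
      have hm : ∀ c ∈ maximalIdeal S, σ c - c ∈ maximalIdeal S ^ (n + 1) := by
        intro c hc
        rw [← hspan] at hc
        induction hc using Submodule.span_induction with
        | mem x hx =>
          obtain ⟨i, rfl⟩ := hx
          simp [hy i]
        | zero => simp
        | add x x' _ _ hx hx' =>
          have h : σ (x + x') - (x + x') = (σ x - x) + (σ x' - x') := by rw [map_add]; ring
          rw [h]
          exact add_mem hx hx'
        | smul b x hx hxn =>
          have hxm : x ∈ maximalIdeal S := by rw [← hspan]; exact hx
          have h : σ (b • x) - b • x = σ b * (σ x - x) + (σ b - b) * x := by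
            rw [smul_eq_mul, map_mul]; ring
          rw [h]
          refine add_mem (Ideal.mul_mem_left _ _ hxn) ?_
          rw [pow_succ]
          exact Ideal.mul_mem_mul (ih b) hxm
      intro a
      obtain ⟨θ, hθ, haθ⟩ := hres a
      have h : σ a - a = σ (a - θ) - (a - θ) := by rw [map_sub, hθ]; ring
      rw [h]
      exact hm _ haθ
  have hmem : σ a - a ∈ ⨅ n : ℕ, maximalIdeal S ^ n := by
    rw [Submodule.mem_iInf]
    exact fun n => key n a
  rw [Ideal.iInf_pow_eq_bot_of_isLocalRing (maximalIdeal S) (maximalIdeal.isMaximal S).ne_top,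
    Submodule.mem_bot] at hmem
  exact sub_eq_zero.mp hmem

omit [Algebra k K] [IsScalarTower k K L] in
/-- **Cossart–Piltant 2008, Lemma 9.4 proof, "`t_i ≢ 0 mod l` for some `i`" — PROVED at finite
level**: in the frame of `exists_eigenvectors_span_maximalIdeal_of_prime_degree` — `S ⊆ L` a
Noetherian local `k`-subalgebra stable under `σ ∈ Aut_K(L)`, eigen-generators `y_i` of `m_S` with
`σ(y_i) = ζ^{t_i} y_i`, and every element of `S` congruent mod `m_S` to a `σ`-fixed element of `S`
("`κ(R) = κ(S)`", `R := S^G`, from Prop. 6.2 (27)) — if `σ` moves some element of `S` (e.g.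
`σ ≠ 1` and `QF(S) = L`), then `ζ^{t_i} ≠ 1` for some `i`.
[cite: CossartPiltant2008, Lemma 9.4, proof (HAL p. 29 l. 20–21)] -/
theorem exists_pow_ne_one_of_exists_apply_ne (S : Subalgebra k L) [IsLocalRing S]
    [IsNoetherianRing S] (σ : L ≃ₐ[K] L) (hstab : ∀ x ∈ S, σ x ∈ S)
    {ι : Type*} (y : ι → ↥(maximalIdeal S))
    (hspan : Ideal.span (Set.range fun i => (y i : S)) = maximalIdeal S)
    {ζ : L} (t : ι → ℕ) (heig : ∀ i, σ ((y i : S) : L) = ζ ^ t i * ((y i : S) : L))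
    (hres : ∀ a : S, ∃ θ : S, σ (θ : L) = θ ∧ a - θ ∈ maximalIdeal S)
    (hmove : ∃ a ∈ S, σ a ≠ a) : ∃ i, ζ ^ t i ≠ 1 := by
  by_contra hall
  simp only [not_exists, not_not] at hall
  -- the restriction of `σ` to `S`
  let σS : S →+* S :=
    ((σ : L ≃ₐ[K] L).toAlgHom.toRingHom.comp (algebraMap S L)).codRestrict S
      (fun x => hstab _ x.2)
  have hσS : ∀ x : S, ((σS x : S) : L) = σ (x : L) := fun x => rfl
  have hfix : ∀ a : S, σS a = a := by
    refine apply_eq_self_of_apply_generators_eq σS (fun i => (y i : S)) hspan ?_ ?_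
    · intro i
      apply Subtype.ext
      rw [hσS, heig i, hall i, one_mul]
    · intro a
      obtain ⟨θ, hθ, haθ⟩ := hres a
      exact ⟨θ, Subtype.ext (by rw [hσS, hθ]), haθ⟩
  obtain ⟨a, haS, ha⟩ := hmove
  apply ha
  have h := congrArg (fun z : S => (z : L)) (hfix ⟨a, haS⟩)
  simpa [hσS] using h

/-! ### "`κ(R) = κ(S)`" for a `G`-stable `S`, elementwise -/

omit [Algebra k K] [IsScalarTower k K L] in
/-- **"By proposition 6.2, we have … `κ(R) = κ(S)`" (HAL p. 29 l. 17–18) for a `G`-stable `S`,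
elementwise — PROVED**: `L/K` finite with `|Aut_K(L)|` invertible in `L` ("`l ≠ p`"), `W` a
valuation ring of `L`, `S ⊆ W` a `k`-subalgebra stable under `Aut_K(L)` ("`S` is stable by `G`"),
every `σ ∈ Aut_K(L)` inertial at `W` (`W(σx − x) > 0` on `W`: "`G = G_i(W/V)`", HAL p. 29 l. 5).
Then every `η ∈ S` is congruent modulo `m_W` to the `Aut_K(L)`-invariant average
`θ = |Aut_K(L)|⁻¹ Σ_σ σ(η) ∈ S` (so `θ ∈ R := S^G`) — the device of (29) with the trivial
character, as in `exists_mem_fixedPoints_inertiaGroup_sub_lt` for `R̃`.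
[cite: CossartPiltant2008, Lemma 9.4, proof (HAL p. 29 l. 17–18); Prop 6.2 (2), (27)] -/
theorem exists_fixed_valuation_sub_lt_of_stable [FiniteDimensional K L]
    (W : ValuationSubring L) (S : Subalgebra k L) (hSW : ∀ x ∈ S, x ∈ W)
    (hstab : ∀ σ : L ≃ₐ[K] L, ∀ x ∈ S, σ x ∈ S)
    (hcard : ((Nat.card (L ≃ₐ[K] L) : ℕ) : L) ≠ 0)
    (hin : ∀ σ : L ≃ₐ[K] L, ∀ x ∈ W, W.valuation (σ x - x) < 1)
    {η : L} (hη : η ∈ S) :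
    ∃ θ ∈ S, (∀ σ : L ≃ₐ[K] L, σ θ = θ) ∧ W.valuation (η - θ) < 1 := by
  classical
  haveI : Fintype (L ≃ₐ[K] L) := Fintype.ofFinite _
  set m : ℕ := Fintype.card (L ≃ₐ[K] L) with hm
  have hm0 : (m : L) ≠ 0 := by rwa [Nat.card_eq_fintype_card] at hcard
  refine ⟨(m : L)⁻¹ * ∑ σ : L ≃ₐ[K] L, σ η, ?_, ?_, ?_⟩
  · -- `θ ∈ S`
    have hminv : ((m : L))⁻¹ ∈ S := by
      have h1 : ((m : L))⁻¹ = algebraMap k L ((m : k)⁻¹) := by rw [map_inv₀, map_natCast]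
      rw [h1]
      exact S.algebraMap_mem _
    exact S.mul_mem hminv (S.sum_mem fun σ _ => hstab σ η hη)
  · -- `θ` is invariant
    intro τ
    rw [map_mul, map_inv₀, map_natCast, map_sum]
    congr 1
    exact Fintype.sum_bijective (fun σ => τ * σ) (Group.mulLeft_bijective τ) _ _ fun σ => by
      rw [AlgEquiv.mul_apply]
  · -- `η − θ ∈ m_W`
    have hηW : η ∈ W := hSW η hη
    have hsplit : η - (m : L)⁻¹ * ∑ σ : L ≃ₐ[K] L, σ η =
        (m : L)⁻¹ * ∑ σ : L ≃ₐ[K] L, (η - σ η) := by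
      rw [Finset.sum_sub_distrib, Finset.sum_const, Finset.card_univ, nsmul_eq_mul, mul_sub,
        ← mul_assoc, inv_mul_cancel₀ hm0, one_mul]
    have hv1 : W.valuation ((m : L)⁻¹) ≤ 1 := by
      rw [W.valuation_le_one_iff]
      have h1 : ((m : L))⁻¹ = algebraMap k L ((m : k)⁻¹) := by rw [map_inv₀, map_natCast]
      rw [h1]
      exact hSW _ (S.algebraMap_mem _)
    have hvS : W.valuation (∑ σ : L ≃ₐ[K] L, (η - σ η)) < 1 :=
      W.valuation.map_sum_lt one_ne_zero fun σ _ => by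
        rw [Valuation.map_sub_swap]; exact hin σ η hηW
    rw [hsplit, map_mul]
    calc W.valuation ((m : L)⁻¹) * W.valuation (∑ σ : L ≃ₐ[K] L, (η - σ η))
        ≤ 1 * W.valuation (∑ σ : L ≃ₐ[K] L, (η - σ η)) := mul_le_mul' hv1 le_rfl
      _ < 1 := by rw [one_mul]; exact hvS

omit [Algebra k K] [Algebra K L] [IsScalarTower k K L] in
/-- For a local `k`-subalgebra `S ⊆ W`, elements of `W`-value `> 0` are non-units of `S`, i.e.
lie in `m_S` (`m_W ∩ S ⊆ m_S`; equality holds for local models, not needed here). [folklore]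
[cite: CossartPiltant2008, Section 3 (HAL p. 4, "`R < V`")] -/
theorem mem_maximalIdeal_of_valuation_lt_one (W : ValuationSubring L) (S : Subalgebra k L)
    [IsLocalRing S] (hSW : ∀ x ∈ S, x ∈ W) (x : S) (hx : W.valuation (x : L) < 1) :
    x ∈ maximalIdeal S := by
  rw [IsLocalRing.mem_maximalIdeal, mem_nonunits_iff]
  rintro ⟨u, hu⟩
  have hprod : (x : L) * (((u⁻¹ : Sˣ) : S) : L) = 1 := by
    rw [← hu, ← Subalgebra.coe_mul, Units.mul_inv, Subalgebra.coe_one]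
  have hy : W.valuation ((((u⁻¹ : Sˣ) : S) : L)) ≤ 1 :=
    (W.valuation_le_one_iff _).mpr (hSW _ (Subtype.mem _))
  have h1 : (1 : W.ValueGroup) ≤ W.valuation (x : L) := by
    have h := mul_le_mul' (le_refl (W.valuation (x : L))) hy
    rwa [mul_one, ← map_mul, hprod, map_one] at h
  exact absurd hx (not_lt.mpr h1)

omit [Algebra k K] [IsScalarTower k K L] in
/-- **Cossart–Piltant 2008, Lemma 9.4 proof, "`t_i ≢ 0 mod l` for some `i`", in the frame of
l. 14–23 — PROVED**: `L/K` finite with `|Aut_K(L)|` invertible in `L`, `W` a valuation ring of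
`L`, `S ⊆ W` a Noetherian local `k`-subalgebra stable under `Aut_K(L)`, every `σ ∈ Aut_K(L)`
inertial at `W` ("`G = G_i(W/V)`"), `(y_i)` eigen-generators of `m_S` for `σ` (`σ y_i = ζ^{t_i} y_i`,
`exists_eigenvectors_span_maximalIdeal_of_prime_degree`). If `σ` moves some element of `S`, then
`ζ^{t_i} ≠ 1` for some `i` (`exists_fixed_valuation_sub_lt_of_stable` supplies "`κ(R) = κ(S)`",
`exists_pow_ne_one_of_exists_apply_ne` the Krull-intersection argument).
[cite: CossartPiltant2008, Lemma 9.4, proof (HAL p. 29 l. 17–21)] -/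
theorem exists_pow_ne_one_of_stable_of_inertial [FiniteDimensional K L]
    (W : ValuationSubring L) (S : Subalgebra k L) [IsLocalRing S] [IsNoetherianRing S]
    (hSW : ∀ x ∈ S, x ∈ W) (hstab : ∀ σ : L ≃ₐ[K] L, ∀ x ∈ S, σ x ∈ S)
    (hcard : ((Nat.card (L ≃ₐ[K] L) : ℕ) : L) ≠ 0)
    (hin : ∀ σ : L ≃ₐ[K] L, ∀ x ∈ W, W.valuation (σ x - x) < 1)
    (σ : L ≃ₐ[K] L) {ι : Type*} (y : ι → ↥(maximalIdeal S))
    (hspan : Ideal.span (Set.range fun i => (y i : S)) = maximalIdeal S)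
    {ζ : L} (t : ι → ℕ) (heig : ∀ i, σ ((y i : S) : L) = ζ ^ t i * ((y i : S) : L))
    (hmove : ∃ a ∈ S, σ a ≠ a) : ∃ i, ζ ^ t i ≠ 1 := by
  refine exists_pow_ne_one_of_exists_apply_ne S σ (hstab σ) y hspan t heig ?_ hmove
  intro a
  obtain ⟨θ, hθS, hθfix, hval⟩ :=
    exists_fixed_valuation_sub_lt_of_stable W S hSW hstab hcard hin a.2
  refine ⟨⟨θ, hθS⟩, hθfix σ, ?_⟩
  apply mem_maximalIdeal_of_valuation_lt_one W S hSW
  rw [Subalgebra.coe_sub]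
  exact hval

end Literature.AlgebraicGeometry.CossartPiltant200819.CP2008
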